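import Summits.AtomisticToContinuum.Crystallization.Theses.GappedShellCensus
import Summits.AtomisticToContinuum.Crystallization.Theorems.TornFree.Negative.TwoCentre
import Summits.AtomisticToContinuum.Crystallization.Theorems.TornFree.Negative.TolFamily
import Summits.AtomisticToContinuum.Crystallization.Theorems.TornFree.Negative.TolTight
import Summits.AtomisticToContinuum.Crystallization.Theorems.TornFree.Negative.StubTwoCentreGeThreeFalse
import Summits.AtomisticToContinuum.Crystallization.Theorems.TornFree.Negative.ThreeCentre
import Summits.AtomisticToContinuum.Crystallization.Theorems.TornFree.Negative.TolMonotone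
import Summits.AtomisticToContinuum.Crystallization.Theorems.TornFree.Negative.BetaMn
import Summits.AtomisticToContinuum.Crystallization.Theorems.TornFree.Negative.BetaMnWide

/-!
# Disproof of `TornFree` (stmt-AtomisticToContinuum-18069) — findings

Crux (route GappedShellCensus, rank 2):
`TornFree : ∀ Y ⊂ ℝ³, ∀ a > 0, (every y ∈ Y gapped-twelve at (a, 1/50, 63/50)) →
  every bond (y,v) (dist ≤ 1.02a) has ≥ 4 common bonded neighbours`.

Disprover seats refuter-cdisprove-stmt-AtomisticToContinuum-18069-0 (cycle 1) and -g2-0 (cycle 2), 2026-08-17;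
extends the rattack seat's work.  VERDICT SO FAR: no kill of the crux AT (1/50, 63/50); but the SAME
statement at tolerance 29/500 (gap ratio 63/50) is FALSE — the β-manganese packing (cycle 2, p156018) —
negative-lane files LANDED (TwoCentre, TolFamily, TolTight, StubTwoCentreGeThreeFalse, ThreeCentre,
TolMonotone, BetaMn — seven with the rattack file); one line stub KILLED.  Everything below is kernel-checked in the
imported `Theorems/TornFree/Negative/*` files unless it is a comment.

## Landed (tree, `Theorems/TornFree/Negative/`)
* `TwoCentre.lean` (rattack, p136213) `tornFree_false_without_allSites`: the two-centre form is false —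
  21 points, bond with both ends gapped-twelve and exactly THREE commons (an S8-like hole: 17 of the
  18 snub-disphenoid bonds on `{y,v,2,3,5,6,13,14}`, the torn bond = its `166°` edge, flanked by two
  would-be octahedral diagonals at `1.300`).
* `TolFamily.lean` (this seat, p140995): the family `TornFreeTol τ γ` (`tornFree_iff_tornFreeTol`:
  crux = member `(1/50, 63/50)` by `Iff.rfl`) and the PERIODIC INTEGER CERTIFICATE REPLAYER
  (`Cert`, `cert_model`, `not_tornFreeTol_of_cert`): any orthorhombic periodic integer configuration
  with decidable shell facts gives "every site gapped-twelve" + the exact commons count of a bond;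
  a bond with `≤ 3` commons then yields `¬ TornFreeTol τ γ` by `decide` — ready for any periodic torn
  witness at any `(τ, γ)`.
* `TolTight.lean` (this seat, p141469) `tornFree_tight`: NON-VACUITY + TIGHTNESS — strained fcc
  (`fcc_cert`, `D = 50`) is an infinite all-gapped-twelve `Y` with a bond of EXACTLY 4 commons (the
  crux hypotheses are satisfiable; `4 ≤` cannot become `5 ≤`).
* `StubTwoCentreGeThreeFalse.lean` (this seat, p141804) `stub_tfTwoCentreGeThree_false`: the picked
  line's Stub 1 ("hard core on Y + both ends gapped-twelve ⇒ ≥ 3 commons") is FALSE — 22 points, TWO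
  commons (kit j022616).  So `c = 2` is NOT a two-centre regime; `TornFree_of` (Lines/Sketch.lean) must
  route `c = 2` into the content stub (third centre), keeping only `2 ≤ #commons` two-centre.

* `ThreeCentre.lean` (this seat, p142415, LANDED 87b0df4a5c08) `tornFree_false_without_allSites3`:
  the THREE-CENTRE form is false — hard core on all of `Y` + `y`, `v` AND a third site `w` (a private
  neighbour of `y`) gapped-twelve, yet `commons(y,v) = 3`: 31 points, slack `0.0101` at `τ = 2 %`
  (feasible down to `τ = 1 %`; kit j022770).  So `k ≥ 4` centres UNDER THESE HYPOTHESES.  CAVEAT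
  (important for provers): the hypotheses leave NON-centre pairs free to sit in the annulus, and the
  witness uses that (24 pairs in `(1.02, 1.26)`, e.g. two commons at `1.247`).  In the ALLGAP regime
  (every pair bond-or-far, non-centres `≤ 12` — the regime of any finite patch of a true
  counterexample) the three-centre cluster at `τ = 2 %` reaches `γ = 1.22` (slack `+0.0009`) but NOT
  `γ = 1.26` (`−0.0019`, one branch, kit j022929 smoke); at `τ = 4 %` it passes (`+0.012`) and the
  allgap 5-centre rung fails so far.  Hard-core-only three-centre `τ_min`: c=3 & w = y-private
  1.0 %, c=3 & w = common 1.5–1.75 %, c=2 & w = common 2.5 %, c=2 & w = y-private 3.25 %; hard-core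
  k-ladder at 4 % passes K = 8 (y, v, w, 3 commons, 2 more y-neighbours) with slack 0.012, using
  annulus pairs among the free shell points (36 of them) — which is exactly what later rungs forbid.
  RUNNING: the k-CENTRE LADDER in both regimes (hard-core-only kit j022919, ALLGAP kit j022996;
  τ ∈ {2,2.5,3,3.5,4,5} %; rungs K = 3,5,6,8,11,…,36 grown breadth-first about the torn bond, ALL
  points relaxed jointly, τ push-down at the deepest rung): deepest rung at 2 % = lower bound on the
  number of centres a certificate needs; γ_max / τ_min of the allgap 3- and 5-centre clusters = the
  margin the gap ratio 63/50 really has (smoke says: razor-thin, ≈ 0.002 of length at 3 centres).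

## Measured two-centre thresholds (kit j022883: 10 217 clusters, c ∈ {0,1,2,3} × τ ∈ [1 %, 5 %])
Two-centre cluster `y, v, c` commons, `11-c` + `11-c` privates; both ends exactly gapped-twelve at
`(τ, 1.26)`, hard core on all pairs; `τ*(c)` = smallest τ on the ladder with non-negative uniform
slack (best of all restarts; a search LOWER bound on feasibility):
  hard core only (Stub 1 hypotheses):          c=3: 1.0 %   c=2: 1.75 %   c=1: 3.0 %   c=0: 4.0 %
  ALLGAP (every pair bond-or-far, ≤ 12 each):  c=3: 1.75 %  c=2: 2.25 %   c=1: 4.0 %   c=0: 4.5 %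
slack at τ = 2 %: hard-core-only c=3 +0.0101, c=2 +0.0033, c=1 −0.0098, c=0 −0.0176;
                  allgap          c=3 +0.0032, c=2 −0.0008, c=1 −0.0149, c=0 −0.0221.
So at the crux's τ = 1/50: TWO ends force `c ≥ 2` (hard core only; margin ≈ 1 % of length) and, if
all pairs avoid the annulus, numerically `c ≥ 3` by a hair (c=2 allgap misses by 0.0008 — NOT a safe
margin for a certificate; τ*(2, allgap) = 2.25 %).
REFLEX SECTORS exist two-centre at 2 % in BOTH regimes: the hard-core-only c=2 cluster has an empty
azimuthal wedge of `263°` in the spool `{0.24 < h < d−0.24, r < 1.16}`; the best ALLGAP c=3 cluster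
(slack +0.0032, zero annulus pairs) has an empty spool wedge of `197°` (> 190°: ideator-2 Part 5's
"reflex sectors absent at 2 %" is an artefact of its 20-start search).  The line's sector words must
therefore include the reflex `TTW`-type case at two AND three centres.

## Why the crux itself resists so far (honest status)
* Three centres are NOT the obstruction (above).  Whether FOUR or more are is exactly what the
  k-ladder measures; the periodic all-twelve search v2 (job1 parts A/B: no-gap phase 1, exact γ
  push-up 1.06→1.26, τ ladder 2–10 %, m ≤ 40, S8/TTP9/GESB10/compound/witness-template plants) is
  queued: kit j022777 / j022778.  Their tables (τ_min of the first periodic torn all-gapped-twelve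
  structure; γ_max per torn topology at τ = 2 %; deepest k-rung) go below when they land.
* Structural reason it is hard: a torn bond needs a hole with a dihedral `≥ 140°` at the bond (S8
  `166°`, GESB10 `158.6°`, hollow icosahedron `138°` — the last is one-centre impossible by area), and
  every such hole has further vertices whose own twelve-shells must absorb corners of `96°/122°/166°`;
  the solid-angle/edge budgets (T = 2·O + 6.33·S8 per cell, e.g. 45 T : 7 S8 per 16 sites) admit no
  small balanced cell, and the one-parameter freedom that rescues two centres (privates leaning into
  the reflex wedge at annulus distances from each other) is exactly what a third centre forbids.
* Dead ends (do not retry): penalty annealing WITH the gap bump (never reaches coordination 12, even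
  m = 4); lattices (12 near-unit vectors ⇒ strained fcc only); hollow ICO12 cages; T/O-only vertex
  types other than (8,6) (solid angle off by ≥ 2 %).

## Cycle 2 (gen-2 seat refuter-cdisprove-stmt-AtomisticToContinuum-18069-g2-0, 2026-08-17) — THE β-MANGANESE WITNESS
* NEW LANDED `TolMonotone.lean` (p154398): the family is MONOTONE — larger τ / smaller γ (window below
  the gap) is a stronger member (`tornFreeTol_mono`); refutations propagate to the quadrant
  `τ ≥ τ₀, γ ≤ γ₀` (`not_tornFreeTol_of_le`); a witness with `τ₀ ≤ 1/50`, `γ₀ ≥ 63/50` kills the crux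
  (`not_tornFree_of_witness_quadrant`, re-exported below as `crux_killing_quadrant`).
* NEW LANDED `BetaMn.lean` (p156018, commit 64814e16fce1): the relaxed β-MANGANESE
  packing (A13, `P4₁32`, 20 sites/cell, literature `x = 0.0636`, `y = 0.2022`) is an infinite periodic
  ALL-gapped-twelve configuration with TORN bonds — per cell 120 bonds with commons `3 ×12`, `4 ×72`,
  `5 ×36`; raw β-Mn sits at `(τ, γ) = (0.0626, 1.297)`.  Kernel-`decide` certificates (M = 20):
  `not_tornFreeTol_betaMn : ¬ TornFreeTol (29/500) (63/50)` and `not_tornFreeTol_betaMn' :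
  ¬ TornFreeTol (3/50) (129/100)`; with `TolMonotone`: `¬ TornFreeTol τ γ` for ALL `τ ≥ 0.058`,
  `γ ≤ 1.26` (window below gap).  So THE CONCLUSION OF THE CRUX IS FALSE AT TOLERANCE 5.8 % WITH THE
  CRUX'S OWN GAP RATIO 63/50: tolerance is load-bearing by a factor `< 2.9`, and every certificate of
  the line's content stub must have τ-dependent (not topological) margins.
* Fixed-topology frontier of β-Mn (all 60 coordinates + orthorhombic box free, bond graph fixed;
  calc/frontier.py in the seat folder): `τ_min ≈ 0.0577` for every `γ ∈ [1.26, 1.29]` (gap inactive;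
  binding = the twelve five-ring Mn1–Mn1 bonds at the window bottom `0.942` against 34 bonds at the top
  `1.058`: polytetrahedral compression, a self-stressed active set of 46 constraints on 60 dof), and
  `γ_max ≈ 1.294 / 1.296 / 1.299` at `τ = 0.058 / 0.060 / 0.0626` (the 1.293-diagonals = S8-type
  ceiling `1.2892(1+τ)`).  To go below 5.77 % the TOPOLOGY must change.
* Structure scan (common exact-twelve window?; τ, γ, commons): MgZn₂ C14 (0.090, 1.139; {3,5} torn),
  scheelite-O (0.152, 1.259; torn), cementite-Fe (0.183, 1.191; torn), α-U (0.0965, 1.301; all 4),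
  In (0.019, 1.388; all 4), α-Hg (0.071, 1.418; all 4), zircon-O (0.162, 1.294; all 4), FeB-Fe
  (0.198, 1.207; all 4); no window: A15, CuAl₂, α-Np, Pa.  β-Mn is the only classical packing found
  that is all-twelve AND torn below 9 %.
* Vertex solid-angle budget (link with V = 12, `F₃ = 20 − 2F₄ − 3F₅`; need
  `Σ_quads(Ω−1.1026) + Σ_pents(Ω−1.6539) = 1.540 sr`): O +0.2567, S8₄ +0.2214, S8₅ +0.660, TTP9₅ +0.753,
  GESB₅ +0.823, ICO +0.981 ⇒ near-balanced types O⁶ (0), S8₅²S8₄ (+0.001), S8₅S8₄⁴ (+0.006),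
  S8₄⁷ (+0.010), TTP9₅O³ (−0.017), GESB₅O²S8₄ (+0.018), S8₅²O (+0.037), ICO·O² (−0.046);
  T+S8 crystal bookkeeping `n_A = 3 n_B + 7 n_C`, 7 S8 : 45 T : 16 sites; S8 belt edges (166.4°) are
  torn automatically ({166.4, 96.2, 96.2} = 358.8°, {166.4, 121.7, T} = 358.6°); S8–S8 share only
  b-faces with pairing (b↔g, g↔b, m↔m); S8 and O do not mix round an edge (best {O,122,122} = 353°).
* RUNNING (kit, one script jobA/: free-topology periodic search → γ/τ frontier per topology →
  orthorhombic snap → integer certificate): j025110 (τ 3–10 %, random / cage seeds), j025138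
  (τ = 2 %, 2.5 % with an almost-empty gap — a torn hit refutes `TornFreeWithoutGap`), j025151
  (crystal-structure seeds), j025434 (β-Mn / MgZn₂ seeds, τ ladder 3–5.5 %: topology surgery near β-Mn).
  The number to watch: `τ_min` over topologies at `γ = 63/50` (now `≤ 0.0577`; crux at `0.02`).

Prose lives in docstrings; every `theorem` here is sorry-free unless its docstring says NEAR-MISS.
-/

noncomputable section

namespace Summit.AtomisticToContinuum.Crystallization.Cruxes.TornFree.Disproof

open Literature.Geometry.DiscreteGeometry
open Summit.AtomisticToContinuum.Crystallization.Theses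
open Summit.AtomisticToContinuum.Crystallization.Theorems.TornFree.Negative

/-- Euclidean 3-space. -/
local notation "E3" => EuclideanSpace ℝ (Fin 3)

/-! ## Pointers to the landed negative knowledge (re-exported for readers of this file) -/

/-- The crux is the member `(1/50, 63/50)` of the landed family `TornFreeTol` (definitional). -/
theorem crux_iff_tol : GappedShellCensus.TornFree ↔ TornFreeTol (1 / 50) (63 / 50) :=
  tornFree_iff_tornFreeTol

/-- Transport: a refutation of the `(1/50, 63/50)` member refutes the crux. -/
theorem not_tornFree_of_not_tol (h : ¬ TornFreeTol (1 / 50) (63 / 50)) :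
    ¬ GappedShellCensus.TornFree :=
  fun h' => h (tornFree_iff_tornFreeTol.1 h')

/-- LOAD-BEARING (all sites): the two-centre form is false (landed, rattack seat). -/
theorem twoCentre_form_false : ¬ TornFreeWithoutAllSites :=
  tornFree_false_without_allSites

/-- TIGHTNESS / NON-VACUITY (landed, this seat): an infinite all-gapped-twelve `Y` with a bond of
exactly four commons exists (strained fcc). -/
theorem hypotheses_satisfiable_and_four_attained :
    ∃ (Y : Set E3) (a : ℝ), 0 < a ∧ Y.Infinite ∧
      (∀ y ∈ Y, ({w ∈ Y | w ≠ y ∧ dist y w ≤ a * (1 + 1 / 50)}.ncard = 12 ∧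
        ∀ w ∈ Y, w ≠ y → a * (1 - 1 / 50) ≤ dist y w ∧
          (dist y w ≤ a * (1 + 1 / 50) ∨ a * (63 / 50) ≤ dist y w))) ∧
      ∃ y ∈ Y, ∃ v ∈ Y, v ≠ y ∧ dist y v ≤ a * (1 + 1 / 50) ∧
        {w ∈ Y | w ≠ y ∧ w ≠ v ∧ dist y w ≤ a * (1 + 1 / 50) ∧
          dist v w ≤ a * (1 + 1 / 50)}.ncard = 4 :=
  tornFree_tight

/-! ## Hypothesis mutation: the gap (empty annulus) dropped — OPEN target of job1 (no-gap phase) -/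

/-- `TornFree` WITHOUT the annulus hypothesis: every site has exactly twelve others within `1.02a`
and none closer than `0.98a`, but points of `Y` MAY lie in `(1.02a, 1.26a)`.  (At `τ = 0` the gap is
automatic — Hales 2012 Lemma 2 / Böröczky–Szabó 2015 Thm 3, `2.518` — so this mutation only exists
at positive tolerance; at `τ = 2 %` a 13th point at radius `≈ 1.03` is already possible, Tammes-13.)
STATUS: no infinite witness yet; every periodic no-gap all-twelve state found so far is Barlow. -/
def TornFreeWithoutGap : Prop :=
  ∀ (Y : Set E3) (a : ℝ), 0 < a →
    (∀ y ∈ Y, {w ∈ Y | w ≠ y ∧ dist y w ≤ a * (1 + 1 / 50)}.ncard = 12 ∧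
      ∀ w ∈ Y, w ≠ y → a * (1 - 1 / 50) ≤ dist y w) →
    ∀ y ∈ Y, ∀ v ∈ Y, v ≠ y → dist y v ≤ a * (1 + 1 / 50) →
      4 ≤ {w ∈ Y | w ≠ y ∧ w ≠ v ∧ dist y w ≤ a * (1 + 1 / 50) ∧ dist v w ≤ a * (1 + 1 / 50)}.ncard

/-- The gap mutation is a weakening of the hypothesis, hence implies the crux (a refutation of
`TornFreeWithoutGap` would show the annulus is load-bearing; a proof of it would prove the crux). -/
theorem tornFree_of_withoutGap : TornFreeWithoutGap → GappedShellCensus.TornFree := by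
  intro h Y a ha hall y hy v hv hvy hd
  exact h Y a ha (fun y hy => ⟨(hall y hy).1, fun w hw hwy => ((hall y hy).2 w hw hwy).1⟩) y hy v hv hvy hd

/-! ## Targets — line `Sketch` (Lines/Sketch.lean), stub by stub

* Stub 1 `stub_tfTwoCentreGeThree`: **KILLED** — `stub_tfTwoCentreGeThree_false` (landed p141804;
  witness `TwoCentreTwoCommonWitness`, 22 points, c = 2, slack 3.27e-3).  Repair the numbers support:
  `2 ≤ #commons` two-centre (c ≤ 1 infeasible at 2 % with ≈ 1 % of length to spare: τ*(1) ≈ 3 %).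
* Stub 2 `stub_tfCircleThree`: TRUE (landed by the line, p140320) — three open 120°-arcs never cover
  the circle.
* Stub 3 `stub_tfEmptySector`: landed (p140167).
* Stub 4 `stub_tfSectorWindows`: TRUE but by a hair on the T side — the extremal quasi-tetrahedral
  sector is the symmetric lens configuration `|yv| = 1.02`, `|yw₁| = |yw₂| = |vw₁| = |vw₂| = 0.98`,
  `|w₁w₂| = 1.02`: `ρ = √(0.98² − 0.51²) = 0.83684`, `cos φ = 1 − 1.0404/(2ρ²) = 0.25717`
  (`φ = 75.10°`) versus the stub's `1/4` (`75.52°`): margin `0.0072` in the cosine (`0.42°`); unequal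
  radii or heights only increase `cos φ`.  Far side: `cos φ ≤ 0.0123` (`φ ≥ 89.3°`) versus `1/10`:
  ample.  No kill; the T constant cannot be lowered below `0.2572`.
* Stub 5 `stub_tfNoWideGapThree` = the crux for `c = 3` (given Stubs 2–4); no separate attack exists —
  see "Why the crux resists".  JOINT SUFFICIENCY: `TornFree_of` is kernel-checked, but with Stub 1
  dead its `c ≤ 2` branch is open again: `c = 2` needs the third centre exactly like `c = 3`
  (and its empty wedge is REFLEX, `≥ 180°` by pigeonhole on two commons — `263°` in the witness).
-/

/-- NEAR-MISS bookkeeping target (not a claim): the corrected two-centre statement the thresholds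
support — `2 ≤ #commons` under Stub 1's hypotheses.  Recorded as a `def` only (no proof attempted
here; c ≤ 1 is two-centre infeasible numerically with τ*(1) ≈ 3 %, τ*(0) ≈ 4.5 %). -/
def StubTwoCentreGeTwo : Prop :=
  ∀ (Y : Set (EuclideanSpace ℝ (Fin 3))) (a : ℝ), 0 < a →
    (∀ p ∈ Y, ∀ q ∈ Y, p ≠ q → a * (1 - 1 / 50) ≤ dist p q) →
    ∀ y ∈ Y, ∀ v ∈ Y, v ≠ y → dist y v ≤ a * (1 + 1 / 50) →
    ({w ∈ Y | w ≠ y ∧ dist y w ≤ a * (1 + 1 / 50)}.ncard = 12 ∧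
      ∀ w ∈ Y, w ≠ y → a * (1 - 1 / 50) ≤ dist y w ∧
        (dist y w ≤ a * (1 + 1 / 50) ∨ a * (63 / 50) ≤ dist y w)) →
    ({w ∈ Y | w ≠ v ∧ dist v w ≤ a * (1 + 1 / 50)}.ncard = 12 ∧
      ∀ w ∈ Y, w ≠ v → a * (1 - 1 / 50) ≤ dist v w ∧
        (dist v w ≤ a * (1 + 1 / 50) ∨ a * (63 / 50) ≤ dist v w)) →
    2 ≤ {w ∈ Y | w ≠ y ∧ w ≠ v ∧ dist y w ≤ a * (1 + 1 / 50) ∧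
      dist v w ≤ a * (1 + 1 / 50)}.ncard


/-! ## Cycle 2: the monotone family and the β-manganese quadrant -/

/-- Re-export (landed p154398): the quadrant that would kill the crux. -/
theorem crux_killing_quadrant {τ₀ γ₀ : ℝ} (hτ : τ₀ ≤ 1 / 50) (hγ : 63 / 50 ≤ γ₀)
    (h : ¬ TornFreeTol τ₀ γ₀) : ¬ GappedShellCensus.TornFree :=
  not_tornFree_of_witness_quadrant hτ hγ h

/-- THREE-CENTRE form false (landed p142415, re-exported). -/
theorem threeCentre_form_false : ¬ TornFreeWithoutAllSites3 :=
  tornFree_false_without_allSites3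

/-- LANDED (p156018): β-manganese refutes the member `(29/500, 63/50)` — same gap ratio as the crux,
tolerance `5.8 %`. -/
theorem betaMn_member_false : ¬ TornFreeTol (29 / 500) (63 / 50) :=
  not_tornFreeTol_betaMn

/-- LANDED (p156018): β-manganese refutes the member `(3/50, 129/100)`. -/
theorem betaMn_member_false' : ¬ TornFreeTol (3 / 50) (129 / 100) :=
  not_tornFreeTol_betaMn'

/-- The β-MANGANESE QUADRANT (landed): the crux's conclusion fails for every tolerance `≥ 29/500` at
every gap ratio `≤ 63/50` (window below the gap).  TOLERANCE IS LOAD-BEARING by a factor `< 2.9`. -/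
theorem betaMn_quadrant {τ γ : ℝ} (hτ : 29 / 500 ≤ τ) (hγ : γ ≤ 63 / 50) (hgap : 1 + τ < 63 / 50) :
    ¬ TornFreeTol τ γ :=
  not_tornFreeTol_of_betaMn hτ hγ hgap

/-- What remains between β-Mn and the crux: the strip `1/50 ≤ τ < 29/500` at `γ = 63/50` (and the
no-gap corner).  Recorded as the family member a free-topology witness must hit next; by
monotonicity any `τ₀` in the strip propagates upward. (Bookkeeping `def`, not a claim.) -/
def OpenStrip (τ₀ : ℝ) : Prop := 1 / 50 ≤ τ₀ ∧ τ₀ < 29 / 500 ∧ ¬ TornFreeTol τ₀ (63 / 50)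

/-- Any point of the open strip below `1/50`… is excluded by definition; any point of it AT `1/50`
kills the crux. -/
theorem crux_false_of_strip_at_crux (h : ¬ TornFreeTol (1 / 50) (63 / 50)) :
    ¬ GappedShellCensus.TornFree :=
  not_tornFree_of_not_tol h


/-! ## Cycle 3 (refuter g3, 2026-08-17): the β-Mn CORNER, its intrinsic width, new torn topologies, apparatus

LANDED: `Negative/BetaMnWide.lean` (p173862) — the first β-Mn integer certificate already certifies
the gap up to `1293/1000` (`min far sqd = 167284018 ≥ 12930²`), so the β-Mn region is ONE quadrant
`29/500 ≤ τ`, `γ ≤ 1293/1000` (`not_tornFreeTol_of_betaMnWide`).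

NUMERICS (this seat; pure-python fixed-topology minimax polish `symscan/sympolish.py`, validated on
β-Mn → `0.057637`; numpy triclinic/orthorhombic polish on kit j027863 `VALID betaMn_polish_tri/ortho`
→ `0.057604`):
* β-Mn's `τ_min = 0.0576` is INTRINSIC to its twelve-shells: identical at `γ = 1.10, 1.16, 1.26, 1.29`
  (gap constraints inactive, thirteenth neighbour at `1.2934 a₀`).  The β-Mn family cannot enter the
  strip `τ < 29/500` at any gap ratio; a strip witness needs a NEW bond topology.
* Symmetry-constrained structure scan (`symscan`: random finite crystallographic groups in cubic /
  tetragonal / orthorhombic / hexagonal cells, 1–3 orbits, ≤ 64 sites, Nelder–Mead on `τ(γ)`): NEW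
  torn all-gapped-twelve periodic topologies exist but all sit ABOVE β-Mn — at `γ = 1.26`:
  tetragonal `[4₃, d-glide]` 64 sites `τ ≈ 0.069` (commons min 2), tetragonal `[4₁, 2₁]` 16 sites
  `τ ≈ 0.076` (commons {3,4,5}), tetragonal `−4` with shift 4 sites `τ ≈ 0.072`; the recurring value
  `0.0718` is the tetragonal-close-packed (rutile anion net) family: 11 contacts + 2 at `1.225`, best
  `(τ, γ) = (0.0718, 1.07…1.28)`.  NO-GAP mode (only `d₁₃ > 1.002 d₁₂` asked): best torn all-twelve
  found `τ = 0.0623` (tetragonal `[−4_d, 2₁ₓ]`, 16 sites, `γ₀ = 1.20`, commons {3,4,5}) — i.e. even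
  WITHOUT the annulus the low-orbit torn structures bottom out near `6 %`.
* One-centre puzzle recorded for the census owners: the graph "hcp shell minus its three
  square–square equatorial bonds" (faces `3⁸ 6³`, degrees `3⁶4⁶`) is INFEASIBLE below `≈ 6 %`
  (finite-cluster minimax, all starts → uniform violation `0.0202` at `t = 4 %`), and rigidly so: the
  two equatorial atoms of a unit are the two points of `S(y,1) ∩ S(T,1) ∩ S(B,1)` with `T, B`
  eclipsed, hence lie in the equatorial plane, and `3·57.4° + 3·76.3° > 360°`.  So the census class
  "`3⁶4⁶`, threshold `1.36 %`" (Lines/Sketch-dossier §3a) has a different bond graph; this seat's own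
  τ-homotopy census (kit j028093) extracts the geometries (dominant class `3²4¹⁰` reproduced locally).
* Where a counterexample can still live (all seats' numbers combined): two centres are feasible at
  `(2 %, 1.26)` (far-triad/S8, `τ_min ≈ 1.6 %`), three centres are not (margins `≥ 4.5e-3`), β-Mn is
  periodic at `5.76 %`: the periodic torn threshold at `γ = 63/50` lies in `(≈ 2.4 %, 5.76 %]`.  The
  crux itself (`2 %`) is numerically safe by `≈ 0.45 %` of length already at three centres; the
  refuter's live targets are strip members `¬ TornFreeTol τ₀ γ₀` with `τ₀ < 29/500` (any `γ₀ > 1 + τ₀`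
  is non-dominated), searched by kit j027909 / j027943 / j028092 (symscan ± polish, torn bonus),
  j028093 (census + no-gap scan), j028177 (numpy basin hopping seeded from β-Mn / fcc / hcp surgery).
* Nearest print to the crux: Böröczky–Szabó, "ε-quasi-twelve-neighbour packings of unit balls in E³",
  Acta Math. Hungar. (2016), doi:10.1007/s10474-016-0583-4 (the tolerance version of the 12-neighbour
  problem; paywalled, acq-00697) and their 2015 "12-neighbour packings" (acq-00699); Hales 2012
  (arXiv:1209.6043) settles `τ = 0` with `h₀ = 1.26`.
-/

/-- **The β-Mn corner** (landed, `BetaMnWide.lean`): `(29/500, 1293/1000)` is false. [folklore] -/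
theorem betaMn_corner_false : ¬ TornFreeTol (29 / 500) (1293 / 1000) :=
  not_tornFreeTol_betaMnWide

/-- The β-Mn quadrant in one statement (landed): tolerance `≥ 29/500`, gap ratio `≤ 1293/1000`,
window below the gap. [folklore] -/
theorem betaMn_wide_quadrant {τ γ : ℝ} (hτ : 29 / 500 ≤ τ) (hγ : γ ≤ 1293 / 1000)
    (hgap : 1 + τ < 1293 / 1000) : ¬ TornFreeTol τ γ :=
  not_tornFreeTol_of_betaMnWide hτ hγ hgap

/-- Two-parameter bookkeeping of what is still open on the negative side: a NON-DOMINATED new witness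
is a refuted member with tolerance below β-Mn's intrinsic `29/500` at ANY gap ratio above its window
(by `TolMonotone` every such point opens a new quadrant).  (Bookkeeping `def`, not a claim.) -/
def OpenRegion (τ₀ γ₀ : ℝ) : Prop := τ₀ < 29 / 500 ∧ 1 + τ₀ < γ₀ ∧ ¬ TornFreeTol τ₀ γ₀

/-- The strip is the `γ₀ = 63/50` slice of the open region. -/
theorem openRegion_of_openStrip {τ₀ : ℝ} (h : OpenStrip τ₀) : OpenRegion τ₀ (63 / 50) :=
  ⟨h.2.1, by obtain ⟨-, hτ, -⟩ := h; linarith, h.2.2⟩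

/-- Only region points with `τ₀ ≤ 1/50` AND `63/50 ≤ γ₀` kill the crux (`crux_killing_quadrant`);
a region point with `γ₀ < 63/50` or `τ₀ > 1/50` is hypothesis analysis only.  Recorded as the
implication that IS available. -/
theorem crux_false_of_region {τ₀ γ₀ : ℝ} (hτ : τ₀ ≤ 1 / 50) (hγ : 63 / 50 ≤ γ₀)
    (h : OpenRegion τ₀ γ₀) : ¬ GappedShellCensus.TornFree :=
  crux_killing_quadrant hτ hγ h.2.2

end Summit.AtomisticToContinuum.Crystallization.Cruxes.TornFree.Disproof

end
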